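import Summits.ValiantsHypothesis.ValiantsHypothesis.Theorems.TwoProducts.RankThreeAffineToricWronskianLetters

/-!
# Toric Wronskians of monomials, part 14: WORD COEFFICIENTS of the ray table under additive independence ((2b-i) of val-idea-crit-8 g6 #128/#129)

Sequel of ✓ `…ToricWronskianLetters` ((2a): `toricWLeadS`, `det_toricWNewt_nodes`, `coeff_finset_prod`) and ✓ `…ToricWronskianDepth` (W4a: `IsWordSupp`,
`isWordSupp_toricW_coef`).  W4a/W4b read the ray table `M_{a,j} = toricW_coef u b q a j` at its ν-DOMINATING point; the located cells AT a merge ((L1′) mixed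
words, (M-a′) deeper pure layers) need its coefficient at an ARBITRARY WORD `v^{a−|S|} ⊔ S` (`v` on the line `det(q,·) = 0`, `S` a multiset of off-line
letters).  This is exact under ★ `AddIndep (supp u) N` — ADDITIVE INDEPENDENCE up to `N` letters (§1; a HYPOTHESIS SHAPE, the one `Prop`-definition of this
file, inhabited by e.g. `{(1,0),(0,1)}`, failing for adversarial sparse supports; val-idea-crit-8 g6's (GP2) made uniform — a genericity cell AT merges whose
consumer LV-2 must later sum over coinciding words; progress on `ConeTopBound`'s `R` is 0 until it is removed).
§1 `AddIndep`; ★ `IsWordSupp.le_card_filter_of_addIndep` / `IsWordSupp.coeff_eq_zero_of_addIndep` (a word with too few off-line letters carries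
coefficient 0); ★ `IsWordSupp.mem_of_coeff_ne_zero` (THE SPLIT LEMMA: if `coeff_{W₀.sum − s} F ≠ 0` for a sum `F` of `a`-letter words and a target word
`W₀` of `a+1` letters, then `s ∈ W₀` and `W₀.sum − s = (W₀ − s).sum`).
§2 letter-by-letter coefficient formulas: `coeff_rayEps_mul` (`coeff_z(ε_{b′}·F) = Σ_{s ≤ z} u_s det(b′,s) coeff_{z−s} F`), `coeff_jac_right`
(`coeff_z J(F,u) = Σ_{s ≤ z} coeff_{z−s}F · u_s · det(z−s, s)`), `idet_antisymm`, `idet_multiset_sum_left`.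
§3 ★★ `toricW_coef_word`: under `AddIndep (supp u) N`, `a ≤ N`, `v ∈ supp u`, `det(q,v) = 0`, letters of `S` in `supp u` off the line:
`coeff ((a − |S|)•v + S.sum) (toricW_coef u b q a |S|) = toricWLeadS β γ κ a S` (`β = u_v det(b,v)`, `γ_p = u_v det(p,v)`, `κ_p = u_p det(q,p)`) — by the
recursion `M_{a+1,j} = ε_b M_{a,j} + J(M_{a,j},u) + ε_q M_{a,j−1}` read at the word: the letter `v` from `ε_b` (`β`), the letter `v` from the `J`-step
(`det(word, v) = Σ_{p∈S} det(p,v)`, i.e. `γ(S)`), a NEW off-line letter `p ∈ S` from `ε_q` (`κ_p`, once per DISTINCT `p` — the monomial coefficient already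
sums the ordered words, which is why ✓ `toricWLeadS` recurses over `S.toFinset`; #129's convention question is thereby settled BY THE KERNEL: for
`S = j·{p}` the identification reproduces ✓ `toricW_coef_lead`'s scalar `toricWLead`, ✓ `toricWLeadS_replicate`), every other split being excluded by the
split lemma.  HONEST LABEL: GP-scoped engine cell on the OPEN rung 3-AFF (side ladder, crux `stmt-ValiantsHypothesis-5906` `TwoProducts`); `ConeTopBound`-uniform,
`OLMLaw`, `RankThreeAffineLaw(Exp)`, `TwoProducts`, PCB, `ResidualLawV25` UNMOVED; 0 summit distance; VP ≠ VNP is NOT proved; no summit statement is proved here.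
`--supports stmt-ValiantsHypothesis-5906 --as helper` (val-port-4 g6; critic of record val-idea-crit-8 g6).  One hypothesis-shape `def … : Prop` with
parameters (`AddIndep`); no instances, no notation, no named facts. [folklore]
-/

noncomputable section
set_option linter.dupNamespace false

namespace Summit.ValiantsHypothesis.ValiantsHypothesis.Theorems.TwoProducts.RankTwoJacobian

open scoped BigOperators
open MvPolynomial
open Literature.LinearAlgebra.Matrix (wronskianMatrix wronskian wronskianMatrix_apply wronskian_def)

section TowerKernel
open scoped Classical

/-! ### §1 Additive independence (hypothesis shape) -/

/-- ADDITIVE INDEPENDENCE of the exponent set `S` up to `N` letters (a HYPOTHESIS SHAPE, NOT asserted — the only `Prop`-definition of this file,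
precedent ✓ `TWFlagBound` / ✓ `MergeFree` / ✓ `ConeTopBound`): two multisets of at most `N` letters from `S` with the same number of letters and the same
sum are EQUAL — so every monomial of every word-sum is reached by ONE word.  Inhabited: `S = {(1,0), (0,1)}` for every `N` (a word is determined by
its sum `(a, b)`); more generally any `S` whose points are «far apart» (generic exponents).  It FAILS for adversarial sparse supports (three collinear
equally spaced points: `2·m = l + r`; the OLM triangle) — it is val-idea-crit-8 g6's (GP2) «no additive coincidence» made uniform: a GENERICITY CELL
at merges, admissible because it computes at resonant vertices; its consumer (LV-2) must later replace it by the sum over coinciding words. -/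
def AddIndep (S : Finset Expo) (N : ℕ) : Prop :=
  ∀ w w' : Multiset Expo, (∀ x ∈ w, x ∈ S) → (∀ x ∈ w', x ∈ S) → Multiset.card w = Multiset.card w' → Multiset.card w ≤ N →
    w.sum = w'.sum → w = w'

/-- under additive independence a support point of a word-sum polynomial (✓ `IsWordSupp`) that is the sum of a word `w₀` forces `w₀` itself to carry the
required number of off-`q` letters. [folklore] -/
theorem IsWordSupp.le_card_filter_of_addIndep {u : Poly2} {q : Expo} {a j N : ℕ} {F : Poly2} (hF : IsWordSupp u q a j F)
    (hA : AddIndep u.support N) (haN : a ≤ N) {w₀ : Multiset Expo} (hw₀ : ∀ x ∈ w₀, x ∈ u.support) (hc₀ : Multiset.card w₀ = a)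
    (hz : w₀.sum ∈ F.support) : j ≤ Multiset.card (w₀.filter fun s => idet q s ≠ 0) := by
  obtain ⟨w, hw, hc, hj, hsum⟩ := hF _ hz
  have heq : w = w₀ := hA w w₀ hw hw₀ (by rw [hc, hc₀]) (by rw [hc]; exact haN) hsum.symm
  rw [← heq]; exact hj

/-- hence a word with too few off-`q` letters carries the coefficient `0`. [folklore] -/
theorem IsWordSupp.coeff_eq_zero_of_addIndep {u : Poly2} {q : Expo} {a j N : ℕ} {F : Poly2} (hF : IsWordSupp u q a j F)
    (hA : AddIndep u.support N) (haN : a ≤ N) {w₀ : Multiset Expo} (hw₀ : ∀ x ∈ w₀, x ∈ u.support) (hc₀ : Multiset.card w₀ = a)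
    (hfew : Multiset.card (w₀.filter fun s => idet q s ≠ 0) < j) : coeff w₀.sum F = 0 := by
  by_contra hne
  exact absurd (hF.le_card_filter_of_addIndep hA haN hw₀ hc₀ (MvPolynomial.mem_support_iff.mpr hne)) (not_le.mpr hfew)

/-- ★ THE SPLIT LEMMA: if `F` is a sum of `a`-letter words and the monomial `W₀.sum − s` (for a target word `W₀` of `a + 1` letters and a letter `s`) carries a
non-zero coefficient of `F`, then `s ∈ W₀` and `W₀.sum − s = (W₀ − s).sum`. [folklore] -/
theorem IsWordSupp.mem_of_coeff_ne_zero {u : Poly2} {q : Expo} {a j N : ℕ} {F : Poly2} (hF : IsWordSupp u q a j F)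
    (hA : AddIndep u.support N) (haN : a + 1 ≤ N) {W₀ : Multiset Expo} (hW₀ : ∀ x ∈ W₀, x ∈ u.support) (hc₀ : Multiset.card W₀ = a + 1)
    {s : Expo} (hs : s ∈ u.support) (hsz : s ≤ W₀.sum) (hne : coeff (W₀.sum - s) F ≠ 0) :
    s ∈ W₀ ∧ (W₀.erase s).sum = W₀.sum - s := by
  obtain ⟨w, hw, hc, -, hsum⟩ := hF _ (MvPolynomial.mem_support_iff.mpr hne)
  have heq : s ::ₘ w = W₀ := by
    refine hA _ _ (fun x hx => ?_) hW₀ (by rw [Multiset.card_cons, hc, hc₀]) (by rw [Multiset.card_cons, hc]; exact haN) ?_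
    · rcases Multiset.mem_cons.mp hx with h | h
      · rw [h]; exact hs
      · exact hw x h
    · rw [Multiset.sum_cons, ← hsum, add_tsub_cancel_of_le hsz]
  have hsW : s ∈ W₀ := by rw [← heq]; exact Multiset.mem_cons_self s w
  refine ⟨hsW, ?_⟩
  have herase : W₀.erase s = w := by rw [← heq, Multiset.erase_cons_head]
  rw [herase, hsum]

/-! ### §2 Coefficients of `ε_b · F` and of `J(F, u)`, letter by letter -/

/-- `coeff_z (ε_{b'} · F) = Σ_{s ∈ supp u, s ≤ z} u_s · det(b', s) · coeff_{z − s} F`. [folklore] -/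
theorem coeff_rayEps_mul (u : Poly2) (b' : Expo) (F : Poly2) (z : Expo) :
    coeff z (rayEps u b' * F) = ∑ s ∈ u.support, if s ≤ z then coeff s u * ((idet b' s : ℤ) : ℂ) * coeff (z - s) F else 0 := by
  unfold rayEps
  rw [Finset.sum_mul, coeff_sum]
  refine Finset.sum_congr rfl fun s _ => ?_
  rw [coeff_monomial_mul']

/-- `idet` is antisymmetric. [folklore] -/
theorem idet_antisymm (a b : Expo) : idet a b = -idet b a := by unfold idet; ring

/-- `coeff_z J(F, u) = Σ_{s ∈ supp u, s ≤ z} coeff_{z − s} F · u_s · det(z − s, s)` — the letter `s` of `u` appended to the monomial `z − s` of `F`. [folklore] -/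
theorem coeff_jac_right (F u : Poly2) (z : Expo) :
    coeff z (jac F u) = ∑ s ∈ u.support, if s ≤ z then coeff (z - s) F * coeff s u * ((idet (z - s) s : ℤ) : ℂ) else 0 := by
  conv_lhs => rw [jac_antisymm, u.as_sum, jac_sum_left, coeff_neg, coeff_sum]
  rw [← Finset.sum_neg_distrib]
  refine Finset.sum_congr rfl fun s _ => ?_
  rw [toricW_jac_monomial, coeff_monomial_mul']
  by_cases h : s ≤ z
  · rw [if_pos h, if_pos h, coeff_rayEps, idet_antisymm]; push_cast; ring
  · rw [if_neg h, if_neg h, neg_zero]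

/-- `det(Σ multiset, v) = Σ det(·, v)` (additivity of `idet` in the first argument over a multiset). [folklore] -/
theorem idet_multiset_sum_left (m : Multiset Expo) (v : Expo) : idet m.sum v = (m.map fun p => idet p v).sum := by
  induction m using Multiset.induction_on with
  | empty => rw [Multiset.sum_zero, Multiset.map_zero, Multiset.sum_zero]; unfold idet; simp
  | cons s m ih => rw [Multiset.sum_cons, Multiset.map_cons, Multiset.sum_cons, toricW_idet_add, ih]

/-! ### §3 The word coefficients of the ray table -/

/-- ★★ **THE WORD COEFFICIENTS OF THE RAY TABLE (under additive independence).**  Let `v ∈ supp u` lie on the line `det(q, ·) = 0` and let `S` be a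
multiset of off-line letters of `supp u` (`det(q, p) ≠ 0`).  If `supp u` is additively independent up to `N ≥ a` letters, the coefficient of the ray
table entry `M_{a,|S|} = toricW_coef u b q a |S|` at the monomial of the word `v^{a−|S|} ⊔ S` is the letter-indexed leading scalar
`toricWLeadS β γ κ a S` (`β = u_v det(b,v)`, `γ_p = u_v det(p,v)`, `κ_p = u_p det(q,p)`) — for `S = j·{p}` this is ✓ `toricW_coef_lead`'s scalar at the
located point, WITHOUT the domination hypothesis but WITH additive independence (the two cells overlap, neither contains the other). -/
theorem toricW_coef_word {u : Poly2} {v q : Expo} {N : ℕ} (hA : AddIndep u.support N) (hv : v ∈ u.support) (hqv : idet q v = 0) (b : Expo) :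
    ∀ a : ℕ, a ≤ N → ∀ S : Multiset Expo, (∀ p ∈ S, p ∈ u.support ∧ idet q p ≠ 0) → Multiset.card S ≤ a →
      coeff ((a - Multiset.card S) • v + S.sum) (toricW_coef u b q a (Multiset.card S)) =
        toricWLeadS (coeff v u * ((idet b v : ℤ) : ℂ)) (fun p => coeff v u * ((idet p v : ℤ) : ℂ)) (fun p => coeff p u * ((idet q p : ℤ) : ℂ)) a S
  | 0, _, S, hS, hcard => by
    have hS0 : S = 0 := Multiset.card_eq_zero.mp (Nat.le_zero.mp hcard)
    subst hS0
    simp [toricW_coef, toricWLeadS]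
  | a + 1, haN, S, hS, hcard => by
    set j := Multiset.card S with hj
    set β : ℂ := coeff v u * ((idet b v : ℤ) : ℂ) with hβ
    set γ : Expo → ℂ := fun p => coeff v u * ((idet p v : ℤ) : ℂ) with hγ
    set κ : Expo → ℂ := fun p => coeff p u * ((idet q p : ℤ) : ℂ) with hκ
    -- the target word and its sum
    set W₀ : Multiset Expo := Multiset.replicate (a + 1 - j) v + S with hW₀
    set z : Expo := (a + 1 - j) • v + S.sum with hz
    have hW₀sum : W₀.sum = z := by rw [hW₀, Multiset.sum_add, Multiset.sum_replicate]
    have hW₀mem : ∀ x ∈ W₀, x ∈ u.support := by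
      intro x hx
      rcases Multiset.mem_add.mp hx with h | h
      · rw [Multiset.eq_of_mem_replicate h]; exact hv
      · exact (hS x h).1
    have hW₀card : Multiset.card W₀ = a + 1 := by rw [hW₀, Multiset.card_add, Multiset.card_replicate, ← hj]; omega
    have hvS : v ∉ S := fun h => (hS v h).2 hqv
    have ih := toricW_coef_word hA hv hqv b a (by omega)
    -- the off-line count of `W₀ − s`
    have hfilter_v : ∀ n : ℕ, Multiset.filter (fun s => idet q s ≠ 0) (Multiset.replicate n v) = 0 := fun n =>
      Multiset.filter_eq_nil.mpr fun x hx => by rw [Multiset.eq_of_mem_replicate hx]; exact not_not.mpr hqv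
    have hfilter_S : ∀ T : Multiset Expo, (∀ p ∈ T, p ∈ u.support ∧ idet q p ≠ 0) → Multiset.filter (fun s => idet q s ≠ 0) T = T :=
      fun T hT => Multiset.filter_eq_self.mpr fun p hp => (hT p hp).2
    -- words with one letter of `S` removed have only `j − 1` off-line letters
    have hfew : ∀ s ∈ S, Multiset.card ((W₀.erase s).filter fun x => idet q x ≠ 0) < j := by
      intro s hsS
      have herase : W₀.erase s = Multiset.replicate (a + 1 - j) v + S.erase s := by
        rw [hW₀, Multiset.erase_add_right_pos _ hsS]
      rw [herase, Multiset.filter_add, hfilter_v, zero_add, hfilter_S _ fun p hp => hS p (Multiset.mem_of_mem_erase hp),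
        Multiset.card_erase_of_mem hsS, hj]
      exact Nat.pred_lt (Multiset.card_pos_iff_exists_mem.mpr ⟨s, hsS⟩).ne'
    -- geometry of the target: `v ≤ z` and `z − v` when `j ≤ a`
    have hvz : j ≤ a → v ≤ z := fun hja => by
      rw [hz, Finsupp.le_def]; intro i
      simp only [Finsupp.add_apply, Finsupp.smul_apply, smul_eq_mul]
      have : 1 ≤ a + 1 - j := by omega
      nlinarith
    have hzv : j ≤ a → z - v = (a - j) • v + S.sum := fun hja => by
      rw [hz, show a + 1 - j = (a - j) + 1 by omega, succ_nsmul,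
        show (a - j) • v + v + S.sum = (a - j) • v + S.sum + v by abel, add_tsub_cancel_right]
    -- a letter `s ≠ v` with a non-zero split coefficient against `M_{a,j}` is impossible
    have hM : IsWordSupp u q a j (toricW_coef u b q a j) := isWordSupp_toricW_coef u b q a j
    have hnone : ∀ s ∈ u.support, s ≠ v → s ≤ z → coeff (z - s) (toricW_coef u b q a j) = 0 := by
      intro s hs hsv hsz
      by_contra hne
      rw [← hW₀sum] at hne hsz
      obtain ⟨hsW, hsum⟩ := hM.mem_of_coeff_ne_zero hA haN hW₀mem hW₀card hs hsz hne
      have hsS : s ∈ S := by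
        rcases Multiset.mem_add.mp hsW with h | h
        · exact absurd (Multiset.eq_of_mem_replicate h) hsv
        · exact h
      rw [← hsum] at hne
      exact hne (hM.coeff_eq_zero_of_addIndep hA (by omega) (fun x hx => hW₀mem x (Multiset.mem_of_mem_erase hx))
        (by rw [Multiset.card_erase_of_mem hsW, hW₀card]; rfl) (hfew s hsS))
    -- unfold the recursion
    simp only [toricW_coef]
    rw [coeff_add, coeff_add]
    -- TERM 1: `ε_b · M_{a,j}` contributes `β · L_a(S)` (the letter `v`)
    have h1 : coeff z (rayEps u b * toricW_coef u b q a j) = β * toricWLeadS β γ κ a S := by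
      rw [coeff_rayEps_mul, Finset.sum_eq_single_of_mem v hv fun s hs hsv => ?_]
      · by_cases hja : j ≤ a
        · rw [if_pos (hvz hja), hzv hja, hj, ih S hS (by omega)]
        · rw [toricW_coef_eq_zero u b q a j (by omega), coeff_zero, mul_zero, toricWLeadS_eq_zero _ _ _ a S (by rw [← hj]; omega),
            mul_zero, ite_self]
      · by_cases hsz : s ≤ z
        · rw [if_pos hsz, hnone s hs hsv hsz, mul_zero]
        · rw [if_neg hsz]
    -- TERM 2: `J(M_{a,j}, u)` contributes `γ(S) · L_a(S)` (the letter `v`, weighted by `det(word, v) = Σ_{p∈S} det(p, v)`)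
    have h2 : coeff z (jac (toricW_coef u b q a j) u) = (S.map γ).sum * toricWLeadS β γ κ a S := by
      rw [coeff_jac_right, Finset.sum_eq_single_of_mem v hv fun s hs hsv => ?_]
      · by_cases hja : j ≤ a
        · have hdet : coeff v u * ((idet ((a - Multiset.card S) • v + S.sum) v : ℤ) : ℂ) = (S.map γ).sum := by
            have hvv : idet v v = 0 := by unfold idet; ring
            rw [toricW_idet_add, toricW_idet_nsmul, hvv, mul_zero, zero_add, idet_multiset_sum_left, Int.cast_multiset_sum,
              Multiset.map_map, hγ, Multiset.sum_map_mul_left]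
            rfl
          rw [if_pos (hvz hja), hzv hja, hj, ih S hS (by omega), mul_assoc, hdet]
          ring
        · rw [toricW_coef_eq_zero u b q a j (by omega), coeff_zero, zero_mul, zero_mul,
            toricWLeadS_eq_zero _ _ _ a S (by rw [← hj]; omega), mul_zero, ite_self]
      · by_cases hsz : s ≤ z
        · rw [if_pos hsz, hnone s hs hsv hsz, zero_mul, zero_mul]
        · rw [if_neg hsz]
    -- TERM 3: `ε_q · M_{a,j−1}` contributes `Σ_{p ∈ S} κ_p · L_a(S − p)` (a new off-line letter)
    have h3 : coeff z (if j = 0 then (0 : Poly2) else rayEps u q * toricW_coef u b q a (j - 1)) =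
        ∑ p ∈ S.toFinset, κ p * toricWLeadS β γ κ a (S.erase p) := by
      by_cases hj0 : j = 0
      · have hS0 : S = 0 := Multiset.card_eq_zero.mp (by rw [← hj]; exact hj0)
        rw [if_pos hj0, coeff_zero, hS0, Multiset.toFinset_zero, Finset.sum_empty]
      rw [if_neg hj0, coeff_rayEps_mul]
      have hM' : IsWordSupp u q a (j - 1) (toricW_coef u b q a (j - 1)) := isWordSupp_toricW_coef u b q a (j - 1)
      have hsub : S.toFinset ⊆ u.support := fun p hp => (hS p (Multiset.mem_toFinset.mp hp)).1
      rw [← Finset.sum_subset hsub ?_]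
      · -- a letter `s ∈ S`: the word `W₀ − s` has `j − 1` off-line letters and `a + 1 − j` letters `v`
        refine Finset.sum_congr rfl fun s hs => ?_
        have hsS : s ∈ S := Multiset.mem_toFinset.mp hs
        have hsW : s ∈ W₀ := Multiset.mem_add.mpr (Or.inr hsS)
        have hsz : s ≤ z := by rw [← hW₀sum]; exact Multiset.le_sum_of_mem hsW
        have herase : W₀.erase s = Multiset.replicate (a + 1 - j) v + S.erase s := by rw [hW₀, Multiset.erase_add_right_pos _ hsS]
        have hcard' : Multiset.card (S.erase s) = j - 1 := by rw [Multiset.card_erase_of_mem hsS, ← hj]; rfl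
        have hsum : z - s = (a - Multiset.card (S.erase s)) • v + (S.erase s).sum := by
          have hsplit : (W₀.erase s).sum + s = W₀.sum := by rw [add_comm, ← Multiset.sum_cons, Multiset.cons_erase hsW]
          rw [← hW₀sum, ← hsplit, add_tsub_cancel_right, herase, Multiset.sum_add, Multiset.sum_replicate, hcard',
            show a - (j - 1) = a + 1 - j by omega]
        rw [if_pos hsz, hsum, ← hcard', ih (S.erase s) (fun p hp => hS p (Multiset.mem_of_mem_erase hp)) (by rw [hcard']; omega)]
      · -- letters outside `S` contribute nothing
        intro s hs hsS
        rw [Multiset.mem_toFinset] at hsS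
        by_cases hsv : s = v
        · subst hsv; rw [hqv]; simp
        by_cases hsz : s ≤ z
        · rw [if_pos hsz]
          by_cases hne : coeff (z - s) (toricW_coef u b q a (j - 1)) = 0
          · rw [hne, mul_zero]
          · exfalso
            rw [← hW₀sum] at hne hsz
            obtain ⟨hsW, -⟩ := hM'.mem_of_coeff_ne_zero hA haN hW₀mem hW₀card hs hsz hne
            rcases Multiset.mem_add.mp hsW with h | h
            · exact hsv (Multiset.eq_of_mem_replicate h)
            · exact hsS h
        · rw [if_neg hsz]
    rw [h1, h2, h3]
    simp only [toricWLeadS]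
    ring

end TowerKernel

end Summit.ValiantsHypothesis.ValiantsHypothesis.Theorems.TwoProducts.RankTwoJacobian

end
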